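import Literature.NumberTheory.Automorphic.ReciprocityGLn
import HarnessLib

/-!
# Harris–Lan–Taylor–Thorne, Thm. A and Varma, Cor. 9.3: the top layer of
`Literature.NumberTheory.Automorphic.exists_galoisRep_of_regularAlgebraic`

D-0014 keeps `Literature/` sorry-free by stating cited results as named facts `def X : Prop`.
The named fact `Literature.NumberTheory.Automorphic.exists_galoisRep_of_regularAlgebraic` (**lang.S27**,
`Literature.NumberTheory.Automorphic.ReciprocityGLn`) says: for `K` totally real or CM and `π`
a regular algebraic cuspidal automorphic representation of `GL_n(𝔸_K)`, for every prime `ℓ` and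
`ι : ℚ̄_ℓ ≃+* ℂ` there is a continuous semisimple `r : Γ_K → GL_n(ℚ̄_ℓ)` which, at **every**
finite place `v ∤ ℓ` at which `π` is unramified with Satake parameter `α`, is unramified with
arithmetic-Frobenius characteristic polynomial `arithFrobPolyOfSatake ι q_v n α`.

Reading the two cited sources against it (fact-owner's audit; the statement is *not*
mis-stated):

* Harris–Lan–Taylor–Thorne, *On the rigid cohomology of certain Shimura varieties*, Res. Math.
  Sci. 3:37 (2016), **Theorem A** (p. 3), as printed: "Let `p` be a rational prime and
  `ı : ℚ̄_p ≅ ℂ`. Suppose that `E` is a CM (or totally real) field and that `π` is a cuspidal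
  automorphic representation of `GL_n(𝔸_E)` such that `π_∞` has the same infinitesimal character
  as an irreducible algebraic representation `ρ_π` of `RS^E_ℚ GL_n`. Then there is a **unique**
  continuous semi-simple representation `r_{p,ı}(π) : G_E → GL_n(ℚ̄_p)` such that, if `q ≠ p`
  is a rational prime **above which `π` is unramified** and if `v ∣ q` is a prime of `E`, then
  `r_{p,ı}(π)` is unramified at `v` and
  `r_{p,ı}(π)|^{ss}_{W_{E_v}} = ı⁻¹ rec_{E_v}(π_v |det|_v^{(1-n)/2})`."  Its existence part
  is **Corollary 7.14** (p. 232, same wording without "unique", with `F-ss`), deduced there from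
  **Theorem 7.13** (p. 232: `F` imaginary CM containing the imaginary quadratic field `F_0`;
  compatibility at `v ∣ q` for `q ≠ p` "which either splits in `F_0` or is unramified in `F`",
  `π` "unramified at all primes of `F` above `q`") "by using lemma 1 of [54]" (Sorensen's
  patching lemma, "the same argument used in the proof of theorem VII.1.9 of [29]"), which
  removes every condition on the field.  **Editions differ**: the 2014 preprint
  (arXiv:1411.6717, Thm. 1 / Thm. A) and the abstract of both versions have the weaker "above
  which `π` **and `E`** are unramified" ("away from `l` and a finite number of rational primes
  above which the CM field or the automorphic representation ramifies"); the theorem as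
  published in the cited journal version (Thm. A, p. 3 = Cor. 7.14, p. 232) requires only that
  `π` be unramified above `q`, and that is what is vendored here (`IsCompatible`).  So the
  published Thm. A gives the compatibility at the places `v` over rational primes `q ≠ p` such
  that `π_w` is unramified for *all* `w ∣ q` (nothing at a place `v` with `π_v` unramified but
  `π_w` ramified for another `w` over the same `q`), and it asserts uniqueness (up to
  isomorphism).
* I. Varma, *Local-global compatibility for regular algebraic cuspidal automorphic
  representations when `ℓ ≠ p`*, Forum Math. Sigma 12 (2024), e21: **Theorem 1** (p. 2; for
  the `r_{p,ı}(π)` of HLTT/Scholze, `F` CM, every `v ∤ p`: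
  `WD(r_{p,ı}(π)|_{G_{F_v}})^{ss} = ı⁻¹ rec_{F_v}(π_v ⊗ |det|_v^{(1-n)/2})^{ss}`), **Theorem 2**
  (p. 2, the `≺` version), **Theorem 9.2** (pp. 30–31; "In particular, if `π` and `F` are
  unramified at `v`, then `r_{p,ı}(π)` is unramified") and **Corollary 9.3** (p. 32): "Suppose
  that `E` is a totally real or CM field and that `π` is a cuspidal automorphic representation
  such that `π_∞` has the same
  infinitesimal character as an algebraic representation of `RS^E_ℚ GL_n`. Then there is a
  continuous semisimple representation `r_{p,ı} : G_E → GL_n(ℚ̄_p)` such that, if `ℓ ≠ p` is a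
  prime and if `v ∣ ℓ` is a prime of `E`, then
  `WD(r_{p,ı}(π)|_{W_{E_v}})^{Frob-ss} ≺ rec_{E_v}(π_v |det|_v^{(1-n)/2})`" (the `ı⁻¹` is
  dropped in print; `≺` is Definition 8.2: equal `W_{E_v}`-types and dominated monodromy
  partitions).  At a place `v ∤ p` where `π_v` is
  unramified the right-hand side is a sum of unramified characters with `N = 0`, so `≺` forces
  `N = 0` and an inertia action through a finite unipotent — hence trivial — group: `r_{p,ı}(π)`
  is unramified at `v` with the predicted characteristic polynomial of Frobenius.  Hence
  `exists_galoisRep_of_regularAlgebraic` is exactly the unramified-place content of Cor. 9.3.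

Neither source is within reach of a Lean proof (fact-owner's triage: **XL**; see "lower
layers").  This file vendors the **top layer** of the decomposition faithfully and proves the
glue, so that the two printed contributions are separated and the uniqueness clause of Thm. A
(absent from **lang.S27**) becomes available:

* `Literature.Lang.IsGaloisCompatibleAt π ι r v` — unramified local–global compatibility of `r` with
  `π` at `v`: for every Satake parameter `α` of `π` at `v`, `r` is unramified at `v` with
  arithmetic-Frobenius characteristic polynomial `arithFrobPolyOfSatake ι q_v n α` (the clause
  of **lang.S27**; vacuous if `π` is ramified at `v`).  API: invariance under change of frame
  (`isGaloisCompatibleAt_conj_iff`).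
* `Literature.Automorphic.AutomorphicRepData.IsUnramifiedAbove π q` — `π` is unramified at every place
  above the rational prime `q` (HLTT's "above which `π` is unramified"; a deliberate dot-notation
  extension of the accepted `AutomorphicRepData` namespace of `AutomorphicRepsGL`).  API:
  `isUnramifiedAbove_cofinite` — granted the named fact `hasSatakeParamAt_cofinite π` (Flath),
  `π` is unramified above all but finitely many rational primes, so Thm. A's compatibility holds
  outside a finite set of places; with the place bookkeeping lemmas
  `natCast_not_mem_of_natCast_mem`, `natPrime_eq_of_natCast_mem`, `exists_natPrime_natCast_mem`
  (every finite place lies over a unique rational prime), all proved.  (Finiteness of the set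
  of places over a given rational prime is already in the tree:
  `Literature.NumberTheory.Automorphic.eventually_natCast_not_mem_asIdeal`, `Literature.NumberTheory.QuadraticForms.finite_setOf_mem_asIdeal`.)
* `Literature.Lang.HarrisLanTaylorThorne2016.IsCompatible π ι r` — the property characterising
  `r_{ℓ,ι}(π)` in the published Thm. A (p. 3) = Cor. 7.14 (p. 232): compatibility at every
  `v ∣ q`, `q ≠ ℓ` a rational prime above which `π` is unramified (no condition on `K` at `q`,
  see "Editions differ" above).
* `Literature.NumberTheory.Automorphic.HarrisLanTaylorThorne2016.theoremA_existence`, `…theoremA_uniqueness` — **Thm. A**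
  as printed (existence; uniqueness up to isomorphism of the underlying continuous
  representations, `ContinuousRep.Equiv`), named facts.
* `Literature.NumberTheory.Automorphic.Varma2024.corollary93_unramified` — the unramified-place consequence of **Thm. 1 /
  Thm. 9.2 / Cor. 9.3** for the representation of Thm. A: every semisimple `r` with HLTT's
  property is compatible with `π` at **every** `v ∤ ℓ` (by `theoremA_uniqueness` such an `r` is
  `r_{ℓ,ι}(π)` up to isomorphism, and compatibility is invariant under isomorphism), named fact.
  Weil–Deligne representations, `rec_{F_v}` for ramified `π_v` and `≺` are not in the tree, so
  only this consequence of the printed statement is vendored (never stronger than the source).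
* `Literature.NumberTheory.Automorphic.exists_galoisRep_of_regularAlgebraic_of` — **assembly**, proved:
  `theoremA_existence → corollary93_unramified → exists_galoisRep_of_regularAlgebraic`.
* `Literature.NumberTheory.Automorphic.HarrisLanTaylorThorne2016.theoremA_existence_of` — proved converse glue:
  **lang.S27** implies the existence half of Thm. A (a place above a rational prime `q ≠ ℓ` does
  not lie above `ℓ`).

No non-vacuity `example` can be given for the predicates (no automorphic representation is
constructible in the tree, as for the parent file); the proved API and the two glue theorems,
which elaborate against the accepted **lang.S27** in both directions, are the sanity checks.

## The printed proofs: the lower layers (plan; none is stateable in the tree today)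

0. *Infrastructure absent from the tree and from Mathlib, needed even to state 2–3*: the local
   Langlands correspondence `rec_{F_v}` for `GL_n` (Harris–Taylor, Henniart), Weil–Deligne
   representations and Grothendieck's monodromy theorem, PEL Shimura varieties with their
   toroidal and minimal compactifications and ordinary loci (Lan), rigid/overconvergent
   cohomology (dagger spaces), `p`-adic automorphic forms, base change for `GL_n`
   (Arthur–Clozel), the Chebotarev density theorem.
1. *Uniqueness in Thm. A*: Chebotarev density plus "traces determine semisimple representations
   in characteristic `0`" (Brauer–Nesbitt), for `r, r' : Γ_K → GL_n(ℚ̄_ℓ)` with equal Frobenius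
   characteristic polynomials at a cofinite set of places (the places over the finitely many bad
   rational primes are finitely many, `π` being unramified almost everywhere,
   `AutomorphicRepData.hasSatakeParamAt_cofinite`).  Stateable with the G09 API (cf. the `ℂ`,
   finite-image version `Literature.NumberTheory.GaloisRepresentations.DeligneSerre1974.lemma32_complex`); its proof needs Chebotarev.
2. *Existence (HLTT pp. 3–4 and §§6–7)*: reduce to an imaginary CM field `F` containing an
   imaginary quadratic field in which `p` splits (base change, Sorensen's patching lemma, the
   argument of Harris–Taylor VII.1.9); realise `Π(N) = Ind(1 × ı⁻¹(π‖det‖^N))^{∞,p}` in the space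
   of overconvergent `p`-adic cusp forms of finite slope on the quasi-split unitary similitude
   group `G_n` (§6: rigid cohomology of the ordinary locus of the minimally compactified Shimura
   variety, boundary computation); Katz's congruences to classical cusp forms of other weights;
   Galois representations for those via the trace-formula lift to `GL_{2n}` and Shin /
   Chenevier–Harris (Cor. 1.3); pseudo-representations give a `2n`-dimensional
   `R_p(ı⁻¹(π‖det‖^N)_∞)` for all `N ≫ 0`; the group-theoretic Prop. 7.12 (= Varma Prop. 9.1)
   isolates the `n`-dimensional `r_{p,ı}(π)`.
3. *All `v ∤ p` (Varma §§5–9)*: elements of the Bernstein centre at `v` split over `F⁺` act on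
   `p`-adic cusp forms through the Hecke algebra with the local-Langlands traces (Prop. 7.1),
   giving Thm. 1; Schneider–Zink types bound the monodromy (Cor. 8.12); Thm. 9.2; Cor. 9.3 by
   patching.

## References

* M. Harris, K.-W. Lan, R. Taylor, J. Thorne, *On the rigid cohomology of certain Shimura
  varieties*, Res. Math. Sci. 3:37 (2016), doi:10.1186/s40687-016-0078-5 — Thm. A (p. 3),
  Cor. 1.3 (p. 31), Prop. 7.12, Thm. 7.13 and Cor. 7.14 (p. 232); preprint arXiv:1411.6717
  (2014), Thm. A with "`π` and `E` unramified above `q`". [HarrisLanTaylorThorneRMS2016]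
* I. Varma, *Local-global compatibility for regular algebraic cuspidal automorphic
  representations when `ℓ ≠ p`*, Forum Math. Sigma 12 (2024), e21, doi:10.1017/fms.2024.7
  (arXiv:1411.2520) — Thm. 1–2 (p. 2), Def. 8.2, Thm. 9.2 (pp. 30–31), Cor. 9.3 (p. 32).
  [VarmaFMS2024]
* P. Scholze, *On torsion in the cohomology of locally symmetric varieties*, Ann. of Math. 182
  (2015), Thm. 1.0.4, Cor. V.4.2 (an independent construction of `r_{p,ı}(π)`, with
  compatibility outside a finite set `S` of places containing those above `p` and those
  ramified over `F⁺`; arXiv:1306.2070, p. 66).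
-/

open scoped MatrixGroups Matrix Classical Polynomial NumberField
open NumberField IsDedekindDomain Field Polynomial Literature.NumberTheory.Automorphic

noncomputable section

/-! ## `π` unramified above a rational prime -/

namespace Literature.NumberTheory.Automorphic.AutomorphicRepData

variable {n : ℕ} {K : Type} [Field K] [NumberField K] {hcpt : isCompact_glFiniteIntegralLevel n K}

/-- `π` is **unramified above the rational prime `q`**: `π` is unramified (has a Satake
parameter, `AutomorphicRepData.IsUnramifiedAt`) at every finite place `w` of `K` dividing `q`
(`(q : 𝓞 K) ∈ w`).  Harris–Lan–Taylor–Thorne 2016, Thm. A ("a rational prime above which `π` is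
unramified"). [cite: HarrisLanTaylorThorneRMS2016, Thm. A] -/
def IsUnramifiedAbove (π : AutomorphicRepData (AutomorphyDatum.gl n K hcpt)) (q : ℕ) : Prop :=
  ∀ w : HeightOneSpectrum (𝓞 K), ((q : ℕ) : 𝓞 K) ∈ w.asIdeal → π.IsUnramifiedAt w

/-- Unfolding lemma for `IsUnramifiedAbove`. [folklore] -/
lemma isUnramifiedAbove_iff (π : AutomorphicRepData (AutomorphyDatum.gl n K hcpt)) (q : ℕ) :
    π.IsUnramifiedAbove q ↔
      ∀ w : HeightOneSpectrum (𝓞 K), ((q : ℕ) : 𝓞 K) ∈ w.asIdeal →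
        ∃ α : Multiset ℂ, π.HasSatakeParamAt w α :=
  Iff.rfl

end Literature.NumberTheory.Automorphic.AutomorphicRepData

/-! ## Finite places and the rational primes below them

General lemmas on finite places of a number field (the place bookkeeping of Thm. A: "a rational
prime above which `π` is unramified", "`v ∣ q`"), kept here as helpers; candidates for Mathlib. -/

namespace Literature.NumberTheory.Automorphic

section Places

variable {K : Type} [Field K] [NumberField K]

omit [NumberField K] in
/-- A finite place lying over a rational prime `q` does not lie over a different rational prime
`p` (a proper ideal contains no two coprime integers). [folklore] -/
lemma natCast_not_mem_of_natCast_mem {v : HeightOneSpectrum (𝓞 K)} {q p : ℕ} (hq : q.Prime)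
    (hp : p.Prime) (hqp : q ≠ p) (hv : ((q : ℕ) : 𝓞 K) ∈ v.asIdeal) :
    ((p : ℕ) : 𝓞 K) ∉ v.asIdeal := by
  intro hpv
  have hcop : IsCoprime ((q : ℕ) : 𝓞 K) ((p : ℕ) : 𝓞 K) :=
    ((Nat.coprime_primes hq hp).2 hqp).cast
  obtain ⟨a, b, hab⟩ := hcop
  have h1 : (1 : 𝓞 K) ∈ v.asIdeal := by
    rw [← hab]
    exact v.asIdeal.add_mem (v.asIdeal.mul_mem_left a hv) (v.asIdeal.mul_mem_left b hpv)
  exact v.isPrime.ne_top ((Ideal.eq_top_iff_one _).2 h1)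

omit [NumberField K] in
/-- Two rational primes lying under the same finite place coincide. [folklore] -/
lemma natPrime_eq_of_natCast_mem {v : HeightOneSpectrum (𝓞 K)} {q p : ℕ} (hq : q.Prime)
    (hp : p.Prime) (hqv : ((q : ℕ) : 𝓞 K) ∈ v.asIdeal) (hpv : ((p : ℕ) : 𝓞 K) ∈ v.asIdeal) :
    q = p :=
  Classical.by_contradiction fun h ↦ natCast_not_mem_of_natCast_mem hq hp h hqv hpv

/-- Every finite place of a number field lies over a rational prime, its residue characteristic
(`ringChar` of the finite residue field `𝓞 K ⧸ v`, Mathlib `FiniteField.card`). [folklore] -/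
lemma exists_natPrime_natCast_mem (v : HeightOneSpectrum (𝓞 K)) :
    ∃ p : ℕ, p.Prime ∧ ((p : ℕ) : 𝓞 K) ∈ v.asIdeal := by
  haveI : v.asIdeal.IsMaximal := v.isMaximal
  letI : Field (𝓞 K ⧸ v.asIdeal) := Ideal.Quotient.field v.asIdeal
  haveI : Finite (𝓞 K ⧸ v.asIdeal) := Ideal.finiteQuotientOfFreeOfNeBot v.asIdeal v.ne_bot
  letI : Fintype (𝓞 K ⧸ v.asIdeal) := Fintype.ofFinite _
  obtain ⟨_, hp, _⟩ := FiniteField.card (𝓞 K ⧸ v.asIdeal) (ringChar (𝓞 K ⧸ v.asIdeal))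
  refine ⟨ringChar (𝓞 K ⧸ v.asIdeal), hp, ?_⟩
  rw [← Ideal.Quotient.eq_zero_iff_mem, map_natCast]
  exact ringChar.Nat.cast_ringChar

/-- **An automorphic representation is unramified above all but finitely many rational primes**,
granted that it is unramified at all but finitely many places (the named fact
`AutomorphicRepData.hasSatakeParamAt_cofinite π` of `AutomorphicRepsGL`, Flath 1979, Thm. 3):
the finitely many ramified places lie over finitely many rational primes
(`exists_natPrime_natCast_mem`, `natPrime_eq_of_natCast_mem`). So the compatibility of Thm. A
holds at all places outside a finite set. [folklore] -/
theorem AutomorphicRepData.isUnramifiedAbove_cofinite {n : ℕ}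
    {hcpt : isCompact_glFiniteIntegralLevel n K}
    (π : AutomorphicRepData (AutomorphyDatum.gl n K hcpt)) (hcof : π.hasSatakeParamAt_cofinite) :
    ∀ᶠ q : ℕ in Filter.cofinite, q.Prime → π.IsUnramifiedAbove q := by
  -- the ramified places, a finite set
  have hB : {w : HeightOneSpectrum (𝓞 K) | ¬ π.IsUnramifiedAt w}.Finite := hcof
  -- the rational primes below them
  choose f hf using fun w : HeightOneSpectrum (𝓞 K) ↦ exists_natPrime_natCast_mem w
  rw [Filter.eventually_cofinite]
  refine (hB.image f).subset fun q hq ↦ ?_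
  simp only [Set.mem_setOf_eq, Classical.not_imp, AutomorphicRepData.IsUnramifiedAbove,
    not_forall] at hq
  obtain ⟨hqprime, w, hqw, hw⟩ := hq
  exact ⟨w, hw, natPrime_eq_of_natCast_mem (hf w).1 hqprime (hf w).2 hqw⟩

end Places

/-! ## Unramified local–global compatibility at one place -/

section Compatible

variable {n : ℕ} {K : Type} [Field K] [NumberField K] {hcpt : isCompact_glFiniteIntegralLevel n K}
  {ℓ : ℕ} [Fact ℓ.Prime]

/-- **Unramified local–global compatibility of `r` with `π` at `v`**: for every Satake parameter
`α` of `π = W / W'` at the finite place `v`, the framed Galois representation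
`r : Γ_K → GL_n(ℚ̄_ℓ)` is unramified at `v` and every arithmetic Frobenius at `v` has
characteristic polynomial `arithFrobPolyOfSatake ι q_v n α = ∏_j (X - ι⁻¹((q_v^{(n-1)/2} α_j)⁻¹))`
(equivalently `r|_{W_{K_v}}^{ss} = ι⁻¹ rec_{K_v}(π_v |det|^{(1-n)/2})` for the unramified `π_v`;
review 13's Frobenius convention, see `ReciprocityGLn`).  This is the compatibility clause of
**lang.S27**; it is vacuous at places where `π` is ramified (no Satake parameter).
Harris–Lan–Taylor–Thorne 2016, Thm. A. [cite: HarrisLanTaylorThorneRMS2016, Thm. A] -/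
def IsGaloisCompatibleAt (π : AutomorphicRepData (AutomorphyDatum.gl n K hcpt))
    (ι : PadicAlgCl ℓ ≃+* ℂ) (r : GaloisRepresentations.FramedGaloisRep K (PadicAlgCl ℓ) n)
    (v : HeightOneSpectrum (𝓞 K)) : Prop :=
  ∀ α : Multiset ℂ, π.HasSatakeParamAt v α →
    r.IsUnramifiedAt v ∧ r.HasFrobCharpolyAt v (arithFrobPolyOfSatake ι v.residueCard n α)

/-- The Frobenius characteristic-polynomial predicate of a framed representation is invariant
under change of frame (`FramedRep.conj`; Mathlib `Matrix.charpoly_units_conj`).  General G09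
API declared here via `_root_` (librarian note: it belongs next to
`FramedGaloisRep.isUnramifiedAt_conj_iff` in `GaloisRepresentations/GaloisRep.lean`; kept in
this leaf file so as not to touch the widely imported G09 file from a fact-owner session).
[folklore] -/
theorem _root_.Literature.NumberTheory.GaloisRepresentations.FramedGaloisRep.hasFrobCharpolyAt_conj_iff {L : Type*} [Field L]
    {A : Type*} [CommRing A] [TopologicalSpace A] [IsTopologicalRing A] {m : ℕ}
    (v : HeightOneSpectrum (𝓞 L)) (P : GL (Fin m) A) (Q : Polynomial A)
    (ρ : GaloisRepresentations.FramedGaloisRep L A m) :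
    GaloisRepresentations.FramedGaloisRep.HasFrobCharpolyAt v Q (GaloisRepresentations.FramedRep.conj P ρ) ↔ ρ.HasFrobCharpolyAt v Q := by
  refine forall₂_congr fun 𝔓 _ => forall₂_congr fun σ _ => ?_
  have h : GaloisRepresentations.FramedRep.charpoly (GaloisRepresentations.FramedRep.conj P ρ) σ = GaloisRepresentations.FramedRep.charpoly ρ σ := by
    simp only [GaloisRepresentations.FramedRep.charpoly, GaloisRepresentations.FramedRep.conj_apply, Units.val_mul, Matrix.coe_units_inv]
    exact Matrix.charpoly_units_conj P _
  rw [h]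

/-- Compatibility at `v` is invariant under change of frame `r ↦ P r P⁻¹`
(`FramedGaloisRep.isUnramifiedAt_conj_iff`, `hasFrobCharpolyAt_conj_iff`). [folklore] -/
theorem isGaloisCompatibleAt_conj_iff (π : AutomorphicRepData (AutomorphyDatum.gl n K hcpt))
    (ι : PadicAlgCl ℓ ≃+* ℂ) (P : GL (Fin n) (PadicAlgCl ℓ))
    (r : GaloisRepresentations.FramedGaloisRep K (PadicAlgCl ℓ) n) (v : HeightOneSpectrum (𝓞 K)) :
    IsGaloisCompatibleAt π ι (GaloisRepresentations.FramedRep.conj P r) v ↔ IsGaloisCompatibleAt π ι r v := by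
  refine forall₂_congr fun α _ => ?_
  rw [GaloisRepresentations.FramedGaloisRep.isUnramifiedAt_conj_iff, GaloisRepresentations.FramedGaloisRep.hasFrobCharpolyAt_conj_iff]

end Compatible

/-! ## Harris–Lan–Taylor–Thorne, Theorem A -/

namespace HarrisLanTaylorThorne2016

section

variable {n : ℕ} {K : Type} [Field K] [NumberField K] {hcpt : isCompact_glFiniteIntegralLevel n K}
  {ℓ : ℕ} [Fact ℓ.Prime]

/-- **HLTT's characterising property of `r_{ℓ,ι}(π)`** (published Thm. A, p. 3 = Cor. 7.14,
p. 232: "if `q ≠ p` is a rational prime above which `π` is unramified and if `v ∣ q` is a prime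
of `E`, then `r_{p,ı}(π)` is unramified at `v` and …"): for every rational prime `q ≠ ℓ` above
which `π` is unramified (`IsUnramifiedAbove`: at *every* place over `q`) and every place `v ∣ q`
of `K`, `r` is compatible with `π` at `v` (`IsGaloisCompatibleAt`: unramified, with the
predicted characteristic polynomial of Frobenius).  No unramifiedness of `K` above `q` is
required in the published theorem (it is in the 2014 preprint arXiv:1411.6717, Thm. A, "above
which `π` and `E` are unramified", and in Thm. 7.13; Cor. 7.14 removes it by Sorensen's
patching lemma — see the module docstring, "Editions differ").
Harris–Lan–Taylor–Thorne 2016, Thm. A (p. 3), Cor. 7.14 (p. 232).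
[cite: HarrisLanTaylorThorneRMS2016, Thm. A and Cor. 7.14] -/
def IsCompatible (π : AutomorphicRepData (AutomorphyDatum.gl n K hcpt)) (ι : PadicAlgCl ℓ ≃+* ℂ)
    (r : GaloisRepresentations.FramedGaloisRep K (PadicAlgCl ℓ) n) : Prop :=
  ∀ q : ℕ, q.Prime → q ≠ ℓ → π.IsUnramifiedAbove q →
    ∀ v : HeightOneSpectrum (𝓞 K), ((q : ℕ) : 𝓞 K) ∈ v.asIdeal → IsGaloisCompatibleAt π ι r v

/-- HLTT-compatibility is invariant under change of frame. [folklore] -/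
theorem isCompatible_conj_iff (π : AutomorphicRepData (AutomorphyDatum.gl n K hcpt))
    (ι : PadicAlgCl ℓ ≃+* ℂ) (P : GL (Fin n) (PadicAlgCl ℓ))
    (r : GaloisRepresentations.FramedGaloisRep K (PadicAlgCl ℓ) n) :
    IsCompatible π ι (GaloisRepresentations.FramedRep.conj P r) ↔ IsCompatible π ι r := by
  simp only [IsCompatible, isGaloisCompatibleAt_conj_iff]

/-- Compatibility at every `v ∤ ℓ` (the conclusion of **lang.S27**) implies HLTT-compatibility
(`natCast_not_mem_of_natCast_mem`). [folklore] -/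
theorem isCompatible_of_forall_not_mem {π : AutomorphicRepData (AutomorphyDatum.gl n K hcpt)}
    {ι : PadicAlgCl ℓ ≃+* ℂ} {r : GaloisRepresentations.FramedGaloisRep K (PadicAlgCl ℓ) n}
    (h : ∀ v : HeightOneSpectrum (𝓞 K), ((ℓ : ℕ) : 𝓞 K) ∉ v.asIdeal →
      IsGaloisCompatibleAt π ι r v) :
    IsCompatible π ι r :=
  fun _q hq hqℓ _ _v hv ↦ h _ (natCast_not_mem_of_natCast_mem hq Fact.out hqℓ hv)

end

/-- **Harris–Lan–Taylor–Thorne 2016, Theorem A — existence** (cf. Scholze, Ann. of Math. 182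
(2015), Cor. V.4.2, an independent construction with compatibility outside a finite set of
places containing those above `ℓ` and those ramified over the maximal totally real
subfield).  Let `K` be a CM or totally real number field and `π` a
cuspidal automorphic representation of `GL_n(𝔸_K)` such that `π_∞` has the same infinitesimal
character as an irreducible algebraic representation of `Res_{K/ℚ} GL_n` (`IsRegularAlgebraic`).
Then for every prime `ℓ` and `ι : ℚ̄_ℓ ≃+* ℂ` there is a continuous semisimple
`r = r_{ℓ,ι}(π) : Γ_K → GL_n(ℚ̄_ℓ)` such that, if `q ≠ ℓ` is a rational prime above which `π` is
unramified and `v ∣ q`, then `r` is unramified at `v` and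
`r|^{ss}_{W_{K_v}} = ι⁻¹ rec_{K_v}(π_v |det|_v^{(1-n)/2})` (as printed in the journal version,
Thm. A, p. 3, and Cor. 7.14, p. 232; the preprint arXiv:1411.6717 and the abstract also ask
that `E` be unramified above `q` — the published statement, vendored here, does not), i.e.
(for the unramified `π_v`, in the tree's arithmetic-Frobenius convention) the characteristic
polynomial of Frobenius is `arithFrobPolyOfSatake ι q_v n α` for the Satake parameter `α` of
`π_v` (`IsCompatible`).  Named fact (D-0014), `∀ hcpt` as in **lang.S27**.
[cite: HarrisLanTaylorThorneRMS2016, Thm. A (p. 3) and Cor. 7.14 (p. 232)] -/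
def theoremA_existence : Prop :=
  ∀ {n : ℕ} {K : Type} [Field K] [NumberField K] (hcpt : isCompact_glFiniteIntegralLevel n K),
    IsTotallyReal K ∨ IsCMField K →
    ∀ (π : CuspidalAutomorphicRepData n K hcpt), π.1.IsRegularAlgebraic → ∀ (ℓ : ℕ) [Fact ℓ.Prime]
      (ι : PadicAlgCl ℓ ≃+* ℂ),
      ∃ r : GaloisRepresentations.FramedGaloisRep K (PadicAlgCl ℓ) n, r.toGaloisRep.IsSemisimple ∧ IsCompatible π.1 ι r

/-- **Harris–Lan–Taylor–Thorne 2016, Theorem A — uniqueness** ("there is a *unique* continuous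
semi-simple representation `r_{p,ı}(π)` such that …"): with `K`, `π`, `ℓ`, `ι` as in
`theoremA_existence`, two continuous semisimple `r, r' : Γ_K → GL_n(ℚ̄_ℓ)` with HLTT's property
(`IsCompatible`) have isomorphic underlying continuous representations on `ℚ̄_ℓⁿ`
(`ContinuousRep.Equiv`; by Chebotarev's density theorem and Brauer–Nesbitt, the places over the
excluded rational primes being finite in number; uniqueness is asserted in Thm. A, p. 3, not
repeated in Cor. 7.14).  Named fact (D-0014).
[cite: HarrisLanTaylorThorneRMS2016, Thm. A (p. 3)] -/
def theoremA_uniqueness : Prop :=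
  ∀ {n : ℕ} {K : Type} [Field K] [NumberField K] (hcpt : isCompact_glFiniteIntegralLevel n K),
    IsTotallyReal K ∨ IsCMField K →
    ∀ (π : CuspidalAutomorphicRepData n K hcpt), π.1.IsRegularAlgebraic → ∀ (ℓ : ℕ) [Fact ℓ.Prime]
      (ι : PadicAlgCl ℓ ≃+* ℂ) (r r' : GaloisRepresentations.FramedGaloisRep K (PadicAlgCl ℓ) n),
      r.toGaloisRep.IsSemisimple → r'.toGaloisRep.IsSemisimple →
        IsCompatible π.1 ι r → IsCompatible π.1 ι r' →
          Nonempty (GaloisRepresentations.ContinuousRep.Equiv r.toGaloisRep r'.toGaloisRep)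

/-- **lang.S27 implies the existence half of Thm. A**: a representation compatible with `π` at
every `v ∤ ℓ` is in particular HLTT-compatible (`isCompatible_of_forall_not_mem`). Proved glue
(the converse direction needs Varma's theorem, `exists_galoisRep_of_regularAlgebraic_of`).
[folklore] -/
theorem theoremA_existence_of (h : exists_galoisRep_of_regularAlgebraic) : theoremA_existence := by
  intro n K _ _ hcpt hK π hπ ℓ _ ι
  obtain ⟨r, hr, hc⟩ := h hcpt hK π hπ ℓ ι
  exact ⟨r, hr, isCompatible_of_forall_not_mem fun v hv α hα ↦ hc v α hα hv⟩

end HarrisLanTaylorThorne2016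

/-! ## Varma, Thm. 1 / Cor. 9.3: compatibility at every `v ∤ ℓ` -/

namespace Varma2024

/-- **Varma 2024, Theorem 1 with Theorem 9.2 and Corollary 9.3 — unramified places.**  Let `K`
be totally real or CM, `π` a regular algebraic cuspidal automorphic representation of
`GL_n(𝔸_K)`, `ℓ` a prime and `ι : ℚ̄_ℓ ≃+* ℂ`.  As printed (Cor. 9.3): there is a continuous
semisimple `r_{ℓ,ι}(π) : Γ_K → GL_n(ℚ̄_ℓ)` with
`WD(r_{ℓ,ι}(π)|_{W_{K_v}})^{Frob-ss} ≺ ι⁻¹ rec_{K_v}(π_v |det|_v^{(1-n)/2})` at **every** place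
`v ∤ ℓ` (Thm. 1: equality of semisimplifications; Thm. 2 and Def. 8.2, `≺`: equal
`W_{K_v}`-types and dominated monodromy), extending Harris–Lan–Taylor–Thorne's Thm. A, whose
representation it is (Thm. A's uniqueness).  Vendored consequence, in the vocabulary of the
tree (no Weil–Deligne representations, no `rec` for ramified `π_v`): every continuous
semisimple `r` with HLTT's property (`HarrisLanTaylorThorne2016.IsCompatible`, i.e.
`r ≅ r_{ℓ,ι}(π)`; compatibility is invariant under isomorphism) is compatible with `π`
(`IsGaloisCompatibleAt`: unramified, with the predicted characteristic polynomial of Frobenius)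
at every `v ∤ ℓ` — at an unramified `π_v` the right-hand side is unramified with `N = 0`, and
`≺` then forces `r` to be unramified at `v` (Thm. 9.2: "in particular … `r_{p,ı}(π)` is
unramified").  As a statement about *every* such `r` it combines the printed Cor. 9.3
(existence of one semisimple representation compatible at every `v ∤ ℓ`, in particular
HLTT-compatible) with the uniqueness clause of HLTT's Thm. A (`theoremA_uniqueness`) and the
invariance of `IsGaloisCompatibleAt` under isomorphism; it is not stronger than these printed
statements together.  Named fact (D-0014), `∀ hcpt`.
[cite: VarmaFMS2024, Thm. 1–2, Thm. 9.2 and Cor. 9.3]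
[cite: HarrisLanTaylorThorneRMS2016, Thm. A (uniqueness clause, p. 3)] -/
def corollary93_unramified : Prop :=
  ∀ {n : ℕ} {K : Type} [Field K] [NumberField K] (hcpt : isCompact_glFiniteIntegralLevel n K),
    IsTotallyReal K ∨ IsCMField K →
    ∀ (π : CuspidalAutomorphicRepData n K hcpt), π.1.IsRegularAlgebraic → ∀ (ℓ : ℕ) [Fact ℓ.Prime]
      (ι : PadicAlgCl ℓ ≃+* ℂ) (r : GaloisRepresentations.FramedGaloisRep K (PadicAlgCl ℓ) n),
      r.toGaloisRep.IsSemisimple → HarrisLanTaylorThorne2016.IsCompatible π.1 ι r →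
        ∀ v : HeightOneSpectrum (𝓞 K), ((ℓ : ℕ) : 𝓞 K) ∉ v.asIdeal → IsGaloisCompatibleAt π.1 ι r v

end Varma2024

/-! ## Assembly of lang.S27 from the top layer -/

/-- **Assembly of lang.S27** (`exists_galoisRep_of_regularAlgebraic`) from its two printed
constituents: Harris–Lan–Taylor–Thorne's Thm. A (existence of the semisimple `r_{ℓ,ι}(π)` with
compatibility above the good rational primes) and Varma's Cor. 9.3 (compatibility of that
representation at every `v ∤ ℓ`). Proved. [cite: VarmaFMS2024, Cor. 9.3] -/
theorem exists_galoisRep_of_regularAlgebraic_of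
    (hA : HarrisLanTaylorThorne2016.theoremA_existence) (hV : Varma2024.corollary93_unramified) :
    exists_galoisRep_of_regularAlgebraic := by
  intro n K _ _ hcpt hK π hπ ℓ _ ι
  obtain ⟨r, hr, hc⟩ := hA hcpt hK π hπ ℓ ι
  exact ⟨r, hr, fun v α hα hv ↦ hV hcpt hK π hπ ℓ ι r hr hc v hv α hα⟩

end Literature.NumberTheory.Automorphic
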